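import Summits.QuantumFields.YangMills.Theorems.BalabanUVNodesN20TameTiltLetterNullClasses
import Summits.QuantumFields.YangMills.Theorems.BalabanUVNodesN20HellingerRoadKeyedAtRecord

/-!
# BalabanUVNodes ∕ node N20 (NE7b) — THE HELLINGER ROAD's V-SIDE KEYED PER TUPLE AT THE READING OF RECORD: wild sets of σ-keys holding every null ∕ one-sided key, the
# two one-run wild masses, radii, ONE tame tilt branch, and the R-side letters at the class weights OF RECORD ⇒ 13U's certificate socket ⇒ K3⁸ BY NAME modulo stub 1's text

Cell `pub-ymgap` (HUMAN RULING D-0062 Track A ∕ director-ym R399 (3a) width seats), WIDTH SEAT `pub-ymgap-dag-n20-w5` (node n20 = NE7b), generation g6,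
CLAIM-5 ∕ INTENT-5 (bus).  Key item K3⁸ `SpineGivenEndpointR13SepCoPHV` (stmt-QuantumFields-27366; skeleton of record v6 b4e55110ab73e679, stub `stub_expansion13HV`),
K3⁷ stmt-QuantumFields-20544 aside; filed `--kind proof --supports … --as helper`.  COUNT-NEUTRAL.  THEOREMS ONLY (0 `def`, 0 `instance`, 0 `notation`, 0 `sorry`).
ADDITIVE — imports this seat's g6 `…N20TameTiltLetterNullClasses` (CLAIM-4: `exists_hybridNE7_of_wildMass_tameTilt_and_response_of_nonneg`) and `…N20HellingerRoadKeyedAtRecord`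
(p642068: `dictionary_of_liveLine`, `weights_nonneg`; through it dag-n20-w3's 13U p637589) — BY NAME; modifies nothing.  Inside the theses cone (via 13U ∕ `K3V6Defs`).

WHY.  p642068 keyed the road's ENDPOINT at the record with the (H) letter DISPLAYED per tuple; CLAIM-4 produces (H) from the V-side letters for NON-NEGATIVE weights with
positivity on the TAME classes only.  This file composes the two AT THE RECORD's carriers `(1, F.side⁴, classSet₁₃ θ 0 g₀, weightA₁₃ θ hP 0 g₀ os, weightB₁₃ θ hP 0 g₀ os)`:
the per-tuple bill of the hellinger road with NO abstract carrier, NO modelling letter, NO positivity letter on wild keys and NO (H) letter — non-negativity, positive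
totals and the E1∕E2 dictionary being theorems (p642068 §1).
* §1 ★★★ `keyedHybridNE7NoBad_of_vSideLettersKeyed_of_liveLine` — per guarded admissible tuple and `(g₀, os)`: (D) derivative carriers of `weightA₁₃ ∕ weightB₁₃` on `|t| ≤ 1`;
  (L) a two-sided live σ-key per `(K, t)`; (Wd) wild sets `W K t ⊆ classSet₁₃ θ 0 g₀ K` with BOTH runs' weights positive OFF them on the window (every null ∕ one-sided key is
  wild); (V‑a) one-run wild masses `≤ wm_K`, `Σ√wm < ∞`; (V‑b) radii `r_K > 0`, `Σ 1∕r_K < ∞`; (KR) ONE bound `𝔅 ≥ 0` and ONE analytic branch of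
  `log(Σ_{tame} weightA₁₃·e^{z(log weightB₁₃ − log weightA₁₃)} ∕ Σ_{tame} weightA₁₃)` on `closedBall 0 r_K` per `(K, t)`; (R′) `Σ R₁ < ∞`; (R‑c) ⇒ 13U's `hH`.
* §2 ★★★ `stubExpansion13HVText_of_vSideLettersKeyed_of_liveLine` (K3⁸ v6 STUB 2's TEXT, 13U BY NAME) · ★★ `spineGivenEndpointR13SepCoPHV_of_stubRates13HVText_of_vSideLettersKeyed_of_liveLine`
  (⊢ the item BY NAME modulo stub 1's v6 text; audit `proof.conditional`, credits nothing).
READING (located, nothing proposed).  (Wd)+(V‑a)+(V‑b)+(KR) are NODE O's objects at the record (which σ-keys are wild at source `t`, their one-run masses along `K`, the tame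
tilt's analytic branch); (D), (R′), (R‑c) the source-current letters; (L) necessary (p642068 `twoSidedKeyed_…`).  Nothing here is typable against the datum today.

HONEST FRAMING.  By-name plumbing through CLAIM-4 + p642068 + 13U on the tree's SHAPES; proves NO estimate; every per-tuple letter, the keyed live line and stub 1's text are
HYPOTHESES inhabited for no tuple (K0⁷ `Record13SepCoPHInhabited` OPEN) and produced by nobody — (V‑b)∕(R′) two-run, UNPRINTED for d = 4; NOT a proof of `stub_expansion13HV`
nor of K3⁸; NOT a refutation; nothing of Bałaban's asserted; NE7 ∕ NE7b ∕ NE7c NOT PRINTED as two-run statements for d = 4, NOT proved; N19′ ∕ N20 ∕ N21 ∕ N27x NOT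
discharged; K3⁸ OPEN (v6 STANDS), K3⁷ aside, neither claimed; no summit statement is proved by this seat; counts UNMOVED (typed 28∕28 · discharged 5∕28; 5∕27 excl.
NODE O).  One finite `𝕋⁴_{L^K}` programme at fixed ε, Bałaban AS PRINTED — R4 closes the conditional finite-𝕋⁴ rung `BalabanLadder.UV` only; NOT ℝ⁴, NOT continuum, NOT OS,
NOT a mass gap, NOT Clay.  0 `def`; 0 `sorry`; standard axioms; no cite tags.
-/

noncomputable section

open Finset
open scoped BigOperators

namespace Summit.QuantumFields.YangMills.BalabanUVNodes.N20HellingerRoadVSideKeyedAtRecord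

open Literature.MathematicalPhysics.QuantumFieldTheory.Balaban1983to89
open Literature.MathematicalPhysics.QuantumFieldTheory.Balaban1983to89.T4Continuum
open Literature.MathematicalPhysics.QuantumFieldTheory.Balaban1983to89.Node00
open T4MatchingAssembly (HybridNE7)
open Summit.QuantumFields.BalabanUV.T4Continuum.Spine
open YMDAG.UVSplit hiding SU
open Summit.QuantumFields.YangMills.Theorems.K3V5Defs (SpineReading RateReadingFn RunSel LetterReading CutReading rrOfRecord GuardedReadingN16
  KeyedRelWeight KeyedShellWeight LiveSel PinnedAtLive)
open Summit.QuantumFields.YangMills.Theorems.K3V6Defs (KeyedRatesHolderD4V KeyedCoreEdgeHolderD4V KeyedExtractionV)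
open Summit.QuantumFields.YangMills.BalabanUVNodes.N20TameTiltLetterNullClasses (exists_hybridNE7_of_wildMass_tameTilt_and_response_of_nonneg)
open Summit.QuantumFields.YangMills.BalabanUVNodes.N20HellingerRoadKeyedAtRecord (dictionary_of_liveLine weights_nonneg)
open Summit.QuantumFields.YangMills.BalabanUVNodes.N20StubTwoTextVOfKeyedHybridCertificate
  (stubExpansion13HVText_of_keyedHybridNE7NoBad_of_liveLine spineGivenEndpointR13SepCoPHV_of_stubRates13HVText_of_keyedHybridNE7NoBad_of_liveLine)

variable {F : T4Family}

/-! ## §1 The per-tuple V-side letters produce 13U's certificate socket -/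

section Socket

/-- **★★★ THE V-SIDE OF THE HELLINGER ROAD KEYED PER TUPLE ⇒ A NO-BAD-CLASS HYBRID CERTIFICATE AT THE RECORD's CARRIERS** (13U's `hH`).  Per guarded admissible tuple
and `(g₀, os)` the letters (D), (L), (Wd), (V‑a), (V‑b)+(KR), (R′), (R‑c) on the class weights OF RECORD (displayed in `hV`, produced by nobody) ⇒ SOME `shA shB Wsh δ`
with `HybridNE7 1 (F.side⁴) (classSet₁₃ θ 0 g₀) (weightA₁₃ …) (weightB₁₃ …) ∅ 0 shA shB Wsh δ` — CLAIM-4's `exists_hybridNE7_of_wildMass_tameTilt_and_response_of_nonneg` at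
`l₀ := 1`, `vol := F.side⁴`, with p642068 §1 discharging non-negativity and the E1∕E2 dictionary under the keyed live line. [bookkeeping] -/
theorem keyedHybridNE7NoBad_of_vSideLettersKeyed_of_liveLine
    (hlive : ∀ (F : T4Family) (θ : Stage13HParams F 2), θ.Provisos₁₃CoPH F 2 → (θ.ZhUnity F 2 ∧ θ.SlotsNondegenerate₁₃ F 2) → θ.Admissible F 2 →
      LiveSel F θ ∧ ZetaMeasurable F 2 θ.ζ)
    (hV : ∀ (F : T4Family) (θ : Stage13HParams F 2) (hP : θ.Provisos₁₃CoPH F 2), (θ.ZhUnity F 2 ∧ θ.SlotsNondegenerate₁₃ F 2) → θ.Admissible F 2 →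
      ∀ (g₀ : ℕ → ℝ) (os : List (ULoop F)),
        letI : DecidableEq (Σ K, SiteSeqKey F (0 + K)) := Classical.decEq _
        ∃ (A' B' : ℕ → ℝ → (Σ K, SiteSeqKey F (0 + K)) → ℝ) (W : ℕ → ℝ → Finset (Σ K, SiteSeqKey F (0 + K))) (wm r R₁ : ℕ → ℝ) (𝔅 χ : ℝ)
          (m : ℕ → ℝ → ℝ),
          -- (D) source-differentiability of the class weights of record on the window
          (∀ (K : ℕ) (s : ℝ), |s| ≤ 1 → ∀ x ∈ classSet₁₃ θ 0 g₀ K, HasDerivAt (fun u => weightA₁₃ θ hP 0 g₀ os K u x) (A' K s x) s) ∧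
          (∀ (K : ℕ) (s : ℝ), |s| ≤ 1 → ∀ x ∈ classSet₁₃ θ 0 g₀ K, HasDerivAt (fun u => weightB₁₃ θ hP 0 g₀ os K u x) (B' K s x) s) ∧
          -- (L) a two-sided live key at every step and source
          (∀ (K : ℕ) (t : ℝ), |t| ≤ 1 → ∃ x ∈ classSet₁₃ θ 0 g₀ K, 0 < weightA₁₃ θ hP 0 g₀ os K t x ∧ 0 < weightB₁₃ θ hP 0 g₀ os K t x) ∧
          -- (Wd) wild sets of keys; both runs live OFF them on the window
          (∀ (K : ℕ) (t : ℝ), W K t ⊆ classSet₁₃ θ 0 g₀ K) ∧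
          (∀ (K : ℕ) (t : ℝ), |t| ≤ 1 → ∀ x ∈ classSet₁₃ θ 0 g₀ K \ W K t, 0 < weightA₁₃ θ hP 0 g₀ os K t x) ∧
          (∀ (K : ℕ) (t : ℝ), |t| ≤ 1 → ∀ x ∈ classSet₁₃ θ 0 g₀ K \ W K t, 0 < weightB₁₃ θ hP 0 g₀ os K t x) ∧
          -- (V‑a) the two one-run wild masses
          (∀ K, 0 ≤ wm K) ∧
          (∀ (K : ℕ) (t : ℝ), |t| ≤ 1 →
            (∑ x ∈ W K t, weightA₁₃ θ hP 0 g₀ os K t x) / (∑ y ∈ classSet₁₃ θ 0 g₀ K, weightA₁₃ θ hP 0 g₀ os K t y) ≤ wm K) ∧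
          (∀ (K : ℕ) (t : ℝ), |t| ≤ 1 →
            (∑ x ∈ W K t, weightB₁₃ θ hP 0 g₀ os K t x) / (∑ y ∈ classSet₁₃ θ 0 g₀ K, weightB₁₃ θ hP 0 g₀ os K t y) ≤ wm K) ∧
          Summable (fun K => Real.sqrt (wm K)) ∧
          -- (V‑b) radii and (KR) ONE bounded analytic tilt branch of the TAME class sums per (K, t)
          (∀ K, 0 < r K) ∧ Summable (fun K => 1 / r K) ∧ 0 ≤ 𝔅 ∧
          (∀ (K : ℕ) (t : ℝ), |t| ≤ 1 → ∃ φ : ℂ → ℂ,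
            DifferentiableOn ℂ φ (Metric.closedBall 0 (r K)) ∧
            (∀ s ∈ Metric.closedBall (0:ℂ) (r K), Complex.exp (φ s)
              = (∑ x ∈ classSet₁₃ θ 0 g₀ K \ W K t, (weightA₁₃ θ hP 0 g₀ os K t x : ℂ)
                  * Complex.exp (s * ((Real.log (weightB₁₃ θ hP 0 g₀ os K t x) - Real.log (weightA₁₃ θ hP 0 g₀ os K t x) : ℝ) : ℂ)))
                / ∑ x ∈ classSet₁₃ θ 0 g₀ K \ W K t, (weightA₁₃ θ hP 0 g₀ os K t x : ℂ)) ∧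
            (∀ s ∈ Metric.closedBall (0:ℂ) (r K), ‖φ s‖ ≤ 𝔅)) ∧
          -- (R′) and (R‑c)
          (∀ (K : ℕ) (s : ℝ), |s| ≤ 1 →
            |∑ x ∈ classSet₁₃ θ 0 g₀ K, weightB₁₃ θ hP 0 g₀ os K s x / (∑ y ∈ classSet₁₃ θ 0 g₀ K, weightB₁₃ θ hP 0 g₀ os K s y)
              * (B' K s x / weightB₁₃ θ hP 0 g₀ os K s x - A' K s x / weightA₁₃ θ hP 0 g₀ os K s x)| ≤ R₁ K) ∧
          Summable R₁ ∧
          (∀ (K : ℕ) (s : ℝ), |s| ≤ 1 →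
            ∑ x ∈ classSet₁₃ θ 0 g₀ K, (weightA₁₃ θ hP 0 g₀ os K s x / (∑ y ∈ classSet₁₃ θ 0 g₀ K, weightA₁₃ θ hP 0 g₀ os K s y)
              + weightB₁₃ θ hP 0 g₀ os K s x / (∑ y ∈ classSet₁₃ θ 0 g₀ K, weightB₁₃ θ hP 0 g₀ os K s y)) / 2
              * (A' K s x / weightA₁₃ θ hP 0 g₀ os K s x - m K s) ^ 2 ≤ χ)) :
    ∀ (F : T4Family) (θ : Stage13HParams F 2) (hP : θ.Provisos₁₃CoPH F 2), (θ.ZhUnity F 2 ∧ θ.SlotsNondegenerate₁₃ F 2) → θ.Admissible F 2 →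
      ∀ (g₀ : ℕ → ℝ) (os : List (ULoop F)),
        letI : DecidableEq (Σ K, SiteSeqKey F (0 + K)) := Classical.decEq _
        ∃ (shA shB : ℕ → ℝ → (Σ K, SiteSeqKey F (0 + K)) → ℝ) (Wsh δ : ℕ → ℝ),
          HybridNE7 1 (F.side ^ 4) (classSet₁₃ θ 0 g₀) (weightA₁₃ θ hP 0 g₀ os) (weightB₁₃ θ hP 0 g₀ os) (fun _ _ => ∅) (fun _ => 0) shA shB Wsh δ := by
  intro F θ hP hG hθ g₀ os
  letI : DecidableEq (Σ K, SiteSeqKey F (0 + K)) := Classical.decEq _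
  obtain ⟨A', B', W, wm, r, R₁, 𝔅, χ, m, hdA, hdB, hlv2, hW, hA, hB, hwm, hwildA, hwildB, hws, hr, hrs, h𝔅, htilt, hR, hRs, hχ⟩ :=
    hV F θ hP hG hθ g₀ os
  obtain ⟨hA0, hB0⟩ := weights_nonneg θ hP g₀ os
  have hZ := dictionary_of_liveLine θ hP (hlive F θ hP hG hθ) g₀ os
  obtain ⟨η, Wsh, shA, shB, -, -, -, hNE7⟩ :=
    exists_hybridNE7_of_wildMass_tameTilt_and_response_of_nonneg (l₀ := 1) (vol := F.side ^ 4)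
      (T := classSet₁₃ θ 0 g₀) (A := weightA₁₃ θ hP 0 g₀ os) (B := weightB₁₃ θ hP 0 g₀ os)
      (Z := fun K t => T4GenFunBounds.schemeZ ((datumOfRecord₁₃CoPH F 2 θ hP).scheme g₀) os (0 + K) t)
      zero_le_one (pow_pos F.side_pos 4) hA0 hB0 hlv2 (fun K t _ => (hZ K t).1) (fun K t _ => (hZ K t).2) hdA hdB
      W hW hA hB wm hwm hwildA hwildB hws r hr hrs h𝔅 htilt hR hRs hχ
  exact ⟨shA, shB, Wsh, _, hNE7⟩

end Socket

/-! ## §2 Hence K3⁸ v6 stub 2's text, and K3⁸ by name modulo stub 1's text [13U BY NAME] -/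

section Texts

/-- **★★★ K3⁸ v6 STUB 2's TEXT FROM THE V-SIDE LETTERS KEYED PER TUPLE AND THE KEYED LIVE LINE** (13U `stubExpansion13HVText_of_keyedHybridNE7NoBad_of_liveLine` on §1).
NOT a proof of `stub_expansion13HV`: `hV` and `hlive` are HYPOTHESES inhabited for no tuple. [bookkeeping] -/
theorem stubExpansion13HVText_of_vSideLettersKeyed_of_liveLine
    (hlive : ∀ (F : T4Family) (θ : Stage13HParams F 2), θ.Provisos₁₃CoPH F 2 → (θ.ZhUnity F 2 ∧ θ.SlotsNondegenerate₁₃ F 2) → θ.Admissible F 2 →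
      LiveSel F θ ∧ ZetaMeasurable F 2 θ.ζ)
    (hV : ∀ (F : T4Family) (θ : Stage13HParams F 2) (hP : θ.Provisos₁₃CoPH F 2), (θ.ZhUnity F 2 ∧ θ.SlotsNondegenerate₁₃ F 2) → θ.Admissible F 2 →
      ∀ (g₀ : ℕ → ℝ) (os : List (ULoop F)),
        letI : DecidableEq (Σ K, SiteSeqKey F (0 + K)) := Classical.decEq _
        ∃ (A' B' : ℕ → ℝ → (Σ K, SiteSeqKey F (0 + K)) → ℝ) (W : ℕ → ℝ → Finset (Σ K, SiteSeqKey F (0 + K))) (wm r R₁ : ℕ → ℝ) (𝔅 χ : ℝ)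
          (m : ℕ → ℝ → ℝ),
          -- (D) source-differentiability of the class weights of record on the window
          (∀ (K : ℕ) (s : ℝ), |s| ≤ 1 → ∀ x ∈ classSet₁₃ θ 0 g₀ K, HasDerivAt (fun u => weightA₁₃ θ hP 0 g₀ os K u x) (A' K s x) s) ∧
          (∀ (K : ℕ) (s : ℝ), |s| ≤ 1 → ∀ x ∈ classSet₁₃ θ 0 g₀ K, HasDerivAt (fun u => weightB₁₃ θ hP 0 g₀ os K u x) (B' K s x) s) ∧
          -- (L) a two-sided live key at every step and source
          (∀ (K : ℕ) (t : ℝ), |t| ≤ 1 → ∃ x ∈ classSet₁₃ θ 0 g₀ K, 0 < weightA₁₃ θ hP 0 g₀ os K t x ∧ 0 < weightB₁₃ θ hP 0 g₀ os K t x) ∧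
          -- (Wd) wild sets of keys; both runs live OFF them on the window
          (∀ (K : ℕ) (t : ℝ), W K t ⊆ classSet₁₃ θ 0 g₀ K) ∧
          (∀ (K : ℕ) (t : ℝ), |t| ≤ 1 → ∀ x ∈ classSet₁₃ θ 0 g₀ K \ W K t, 0 < weightA₁₃ θ hP 0 g₀ os K t x) ∧
          (∀ (K : ℕ) (t : ℝ), |t| ≤ 1 → ∀ x ∈ classSet₁₃ θ 0 g₀ K \ W K t, 0 < weightB₁₃ θ hP 0 g₀ os K t x) ∧
          -- (V‑a) the two one-run wild masses
          (∀ K, 0 ≤ wm K) ∧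
          (∀ (K : ℕ) (t : ℝ), |t| ≤ 1 →
            (∑ x ∈ W K t, weightA₁₃ θ hP 0 g₀ os K t x) / (∑ y ∈ classSet₁₃ θ 0 g₀ K, weightA₁₃ θ hP 0 g₀ os K t y) ≤ wm K) ∧
          (∀ (K : ℕ) (t : ℝ), |t| ≤ 1 →
            (∑ x ∈ W K t, weightB₁₃ θ hP 0 g₀ os K t x) / (∑ y ∈ classSet₁₃ θ 0 g₀ K, weightB₁₃ θ hP 0 g₀ os K t y) ≤ wm K) ∧
          Summable (fun K => Real.sqrt (wm K)) ∧
          -- (V‑b) radii and (KR) ONE bounded analytic tilt branch of the TAME class sums per (K, t)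
          (∀ K, 0 < r K) ∧ Summable (fun K => 1 / r K) ∧ 0 ≤ 𝔅 ∧
          (∀ (K : ℕ) (t : ℝ), |t| ≤ 1 → ∃ φ : ℂ → ℂ,
            DifferentiableOn ℂ φ (Metric.closedBall 0 (r K)) ∧
            (∀ s ∈ Metric.closedBall (0:ℂ) (r K), Complex.exp (φ s)
              = (∑ x ∈ classSet₁₃ θ 0 g₀ K \ W K t, (weightA₁₃ θ hP 0 g₀ os K t x : ℂ)
                  * Complex.exp (s * ((Real.log (weightB₁₃ θ hP 0 g₀ os K t x) - Real.log (weightA₁₃ θ hP 0 g₀ os K t x) : ℝ) : ℂ)))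
                / ∑ x ∈ classSet₁₃ θ 0 g₀ K \ W K t, (weightA₁₃ θ hP 0 g₀ os K t x : ℂ)) ∧
            (∀ s ∈ Metric.closedBall (0:ℂ) (r K), ‖φ s‖ ≤ 𝔅)) ∧
          -- (R′) and (R‑c)
          (∀ (K : ℕ) (s : ℝ), |s| ≤ 1 →
            |∑ x ∈ classSet₁₃ θ 0 g₀ K, weightB₁₃ θ hP 0 g₀ os K s x / (∑ y ∈ classSet₁₃ θ 0 g₀ K, weightB₁₃ θ hP 0 g₀ os K s y)
              * (B' K s x / weightB₁₃ θ hP 0 g₀ os K s x - A' K s x / weightA₁₃ θ hP 0 g₀ os K s x)| ≤ R₁ K) ∧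
          Summable R₁ ∧
          (∀ (K : ℕ) (s : ℝ), |s| ≤ 1 →
            ∑ x ∈ classSet₁₃ θ 0 g₀ K, (weightA₁₃ θ hP 0 g₀ os K s x / (∑ y ∈ classSet₁₃ θ 0 g₀ K, weightA₁₃ θ hP 0 g₀ os K s y)
              + weightB₁₃ θ hP 0 g₀ os K s x / (∑ y ∈ classSet₁₃ θ 0 g₀ K, weightB₁₃ θ hP 0 g₀ os K s y)) / 2
              * (A' K s x / weightA₁₃ θ hP 0 g₀ os K s x - m K s) ^ 2 ≤ χ)) :
    ∀ β : ℝ, 2 / 3 < β → β < 1 →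
      ∀ (𝔯 : RateReading₁₃CoPH 2) (ksel : RunSel) (ℓ : LetterReading) (ℓ₃ : T4Family → Node00.NE3Letters₁₁) (g B : T4Family → ℝ),
        GuardedReadingN16 𝔯 ksel ℓ ℓ₃ g B → KeyedRatesHolderD4V β (rrOfRecord 𝔯 ksel) →
        ∃ (jc : CutReading) (sh : ShellSplit₁₃CoPH 2 0) (cr : SpineReading), PinnedAtLive jc sh cr ∧
          KeyedRelWeight cr ∧ KeyedShellWeight cr ∧ KeyedExtractionV cr ∧ KeyedCoreEdgeHolderD4V β cr (rrOfRecord 𝔯 ksel) :=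
  stubExpansion13HVText_of_keyedHybridNE7NoBad_of_liveLine (keyedHybridNE7NoBad_of_vSideLettersKeyed_of_liveLine hlive hV) hlive

/-- **★★ K3⁸ BY NAME MODULO STUB 1's v6 TEXT, FROM THE V-SIDE LETTERS KEYED PER TUPLE** (13U
`spineGivenEndpointR13SepCoPHV_of_stubRates13HVText_of_keyedHybridNE7NoBad_of_liveLine` on §1).  NOT a proof of K3⁸: all inputs are HYPOTHESES; the audit records
`proof.conditional`; nothing is credited. [bookkeeping] -/
theorem spineGivenEndpointR13SepCoPHV_of_stubRates13HVText_of_vSideLettersKeyed_of_liveLine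
    (h₁ : ∃ β : ℝ, 2 / 3 < β ∧ β < 1 ∧
      ∃ (𝔯 : RateReading₁₃CoPH 2) (ksel : RunSel) (ℓ : LetterReading) (ℓ₃ : T4Family → Node00.NE3Letters₁₁) (g B : T4Family → ℝ),
        GuardedReadingN16 𝔯 ksel ℓ ℓ₃ g B ∧ KeyedRatesHolderD4V β (rrOfRecord 𝔯 ksel))
    (hlive : ∀ (F : T4Family) (θ : Stage13HParams F 2), θ.Provisos₁₃CoPH F 2 → (θ.ZhUnity F 2 ∧ θ.SlotsNondegenerate₁₃ F 2) → θ.Admissible F 2 →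
      LiveSel F θ ∧ ZetaMeasurable F 2 θ.ζ)
    (hV : ∀ (F : T4Family) (θ : Stage13HParams F 2) (hP : θ.Provisos₁₃CoPH F 2), (θ.ZhUnity F 2 ∧ θ.SlotsNondegenerate₁₃ F 2) → θ.Admissible F 2 →
      ∀ (g₀ : ℕ → ℝ) (os : List (ULoop F)),
        letI : DecidableEq (Σ K, SiteSeqKey F (0 + K)) := Classical.decEq _
        ∃ (A' B' : ℕ → ℝ → (Σ K, SiteSeqKey F (0 + K)) → ℝ) (W : ℕ → ℝ → Finset (Σ K, SiteSeqKey F (0 + K))) (wm r R₁ : ℕ → ℝ) (𝔅 χ : ℝ)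
          (m : ℕ → ℝ → ℝ),
          -- (D) source-differentiability of the class weights of record on the window
          (∀ (K : ℕ) (s : ℝ), |s| ≤ 1 → ∀ x ∈ classSet₁₃ θ 0 g₀ K, HasDerivAt (fun u => weightA₁₃ θ hP 0 g₀ os K u x) (A' K s x) s) ∧
          (∀ (K : ℕ) (s : ℝ), |s| ≤ 1 → ∀ x ∈ classSet₁₃ θ 0 g₀ K, HasDerivAt (fun u => weightB₁₃ θ hP 0 g₀ os K u x) (B' K s x) s) ∧
          -- (L) a two-sided live key at every step and source
          (∀ (K : ℕ) (t : ℝ), |t| ≤ 1 → ∃ x ∈ classSet₁₃ θ 0 g₀ K, 0 < weightA₁₃ θ hP 0 g₀ os K t x ∧ 0 < weightB₁₃ θ hP 0 g₀ os K t x) ∧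
          -- (Wd) wild sets of keys; both runs live OFF them on the window
          (∀ (K : ℕ) (t : ℝ), W K t ⊆ classSet₁₃ θ 0 g₀ K) ∧
          (∀ (K : ℕ) (t : ℝ), |t| ≤ 1 → ∀ x ∈ classSet₁₃ θ 0 g₀ K \ W K t, 0 < weightA₁₃ θ hP 0 g₀ os K t x) ∧
          (∀ (K : ℕ) (t : ℝ), |t| ≤ 1 → ∀ x ∈ classSet₁₃ θ 0 g₀ K \ W K t, 0 < weightB₁₃ θ hP 0 g₀ os K t x) ∧
          -- (V‑a) the two one-run wild masses
          (∀ K, 0 ≤ wm K) ∧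
          (∀ (K : ℕ) (t : ℝ), |t| ≤ 1 →
            (∑ x ∈ W K t, weightA₁₃ θ hP 0 g₀ os K t x) / (∑ y ∈ classSet₁₃ θ 0 g₀ K, weightA₁₃ θ hP 0 g₀ os K t y) ≤ wm K) ∧
          (∀ (K : ℕ) (t : ℝ), |t| ≤ 1 →
            (∑ x ∈ W K t, weightB₁₃ θ hP 0 g₀ os K t x) / (∑ y ∈ classSet₁₃ θ 0 g₀ K, weightB₁₃ θ hP 0 g₀ os K t y) ≤ wm K) ∧
          Summable (fun K => Real.sqrt (wm K)) ∧
          -- (V‑b) radii and (KR) ONE bounded analytic tilt branch of the TAME class sums per (K, t)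
          (∀ K, 0 < r K) ∧ Summable (fun K => 1 / r K) ∧ 0 ≤ 𝔅 ∧
          (∀ (K : ℕ) (t : ℝ), |t| ≤ 1 → ∃ φ : ℂ → ℂ,
            DifferentiableOn ℂ φ (Metric.closedBall 0 (r K)) ∧
            (∀ s ∈ Metric.closedBall (0:ℂ) (r K), Complex.exp (φ s)
              = (∑ x ∈ classSet₁₃ θ 0 g₀ K \ W K t, (weightA₁₃ θ hP 0 g₀ os K t x : ℂ)
                  * Complex.exp (s * ((Real.log (weightB₁₃ θ hP 0 g₀ os K t x) - Real.log (weightA₁₃ θ hP 0 g₀ os K t x) : ℝ) : ℂ)))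
                / ∑ x ∈ classSet₁₃ θ 0 g₀ K \ W K t, (weightA₁₃ θ hP 0 g₀ os K t x : ℂ)) ∧
            (∀ s ∈ Metric.closedBall (0:ℂ) (r K), ‖φ s‖ ≤ 𝔅)) ∧
          -- (R′) and (R‑c)
          (∀ (K : ℕ) (s : ℝ), |s| ≤ 1 →
            |∑ x ∈ classSet₁₃ θ 0 g₀ K, weightB₁₃ θ hP 0 g₀ os K s x / (∑ y ∈ classSet₁₃ θ 0 g₀ K, weightB₁₃ θ hP 0 g₀ os K s y)
              * (B' K s x / weightB₁₃ θ hP 0 g₀ os K s x - A' K s x / weightA₁₃ θ hP 0 g₀ os K s x)| ≤ R₁ K) ∧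
          Summable R₁ ∧
          (∀ (K : ℕ) (s : ℝ), |s| ≤ 1 →
            ∑ x ∈ classSet₁₃ θ 0 g₀ K, (weightA₁₃ θ hP 0 g₀ os K s x / (∑ y ∈ classSet₁₃ θ 0 g₀ K, weightA₁₃ θ hP 0 g₀ os K s y)
              + weightB₁₃ θ hP 0 g₀ os K s x / (∑ y ∈ classSet₁₃ θ 0 g₀ K, weightB₁₃ θ hP 0 g₀ os K s y)) / 2
              * (A' K s x / weightA₁₃ θ hP 0 g₀ os K s x - m K s) ^ 2 ≤ χ)) :
    Summit.QuantumFields.YangMills.Theses.BalabanUVNodes.SpineGivenEndpointR13SepCoPHV :=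
  spineGivenEndpointR13SepCoPHV_of_stubRates13HVText_of_keyedHybridNE7NoBad_of_liveLine h₁ (keyedHybridNE7NoBad_of_vSideLettersKeyed_of_liveLine hlive hV) hlive

end Texts

end Summit.QuantumFields.YangMills.BalabanUVNodes.N20HellingerRoadVSideKeyedAtRecord

end
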